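import Literature.MathematicalPhysics.QuantumFieldTheory.BalabanImbrieJaffe1984to88.BIJ88ScalarSummary583

/-!
# `BalabanImbrieJaffe1984to88.BIJ88BasicForms331` — T. Bałaban, J. Imbrie, A. Jaffe, *Effective action and cluster properties of the
abelian Higgs model*, Commun. Math. Phys. **114** (1988) 257–315 [BalabanImbrieJaffe1988], §3 *The First Renormalization Transformation*,
p. 270: the passage (3.29) → (3.30) → **(3.31)** — *"we obtain the basic quadratic forms in φ^{(0)} and ψ"* — PROVED as the step-0 instance
(no localization `Λ₈^{(k−1)′}` on `φ`) of the §5.8 computation `BIJ88ScalarSummary583.Ops.eq583` ((5.8.1)–(5.8.3)), with the print's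
*"neglecting terms at ∂Λ₇^{(0)} and local terms [range O(r(e₀))]"* made EXPLICIT

statement-level skeleton of published theorems with citation tags; proofs where landed; nothing here is a claim about the Yang–Mills mass gap

PDF held: `paper:balaban1988-cmp114-bij-abelian-higgs-effective-action` (journal page = PDF page + 256).  Render read this session as image:
p. 270 = PDF 14 (`pages/original-p014-x2.png` in the p02 gen-5 seat folder).

**What the paper prints (p. 270, verbatim).**  *"The expansion yields for the scalar field forms ½aL⁻²⟨ψ − Q(u)φ, ψ − Q(u)φ⟩ + ½⟨φ, −Δ_uφ⟩ =
½aL⁻²⟨ψ − Q(u₁)φ, ψ − Q(u₁)φ⟩ + ½⟨φ, −Δ_{u₁}φ⟩ + R^{(0)}(u₁, θ₀A^{(0)}) + Σ_□ W₁^{(0)}(□), (3.29) … The next step is a scalar field translation to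
remove the term linear in φ in (3.29). Again we make a local translation, φ = φ^{(0)} + aL⁻²Λ₇^{(0)}C^{(0)}_{loc}(u₁)Q*(u₁)ψ. (3.30)  Neglecting terms
at ∂Λ₇^{(0)} and local terms [range O(r(e₀))] of the order of e^{−cr(e₀)}, we obtain the basic quadratic forms in φ^{(0)} and ψ:
½⟨φ^{(0)}, (−Δ_{u₁} + aL⁻²Q(u₁)*Q(u₁))φ^{(0)}⟩ + ½⟨Λ₈^{(0)′}ψ, Δ^L_{1,loc}(u₁)Λ₈^{(0)′}ψ⟩. (3.31)"*

**What is reproduced here (kernel-checked, zero `sorry`, no new definitions, no named facts).**  On the §5.8 dictionary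
`BIJ88ScalarSummary583.Ops M N F` read at step 0 — `a` = aL⁻², `Δ` = −Δ_{u₁}, `P` = Q(u₁)*Q(u₁) ((4.10)), `Q` = Q(u₁), `Λ7` = Λ₇^{(0)}, `Cloc` =
C^{(0)}_{loc}(u₁), `Λ8'` = Λ₈^{(0)′}, the translation `Ops.T` = (3.30) = (5.8.1) at k = 0, and **`Λ8 = id`** (the forms of (3.29) carry no
`Λ₈^{(−1)′}`):
* `Q4_eq_zero_of_id` — with no `φ`-localization the form `𝒬₄` of (5.8.2) is absent;
* **`eq331`** — the two quadratic forms of (3.29) at `u₁`, after (3.30), EQUAL the basic forms (3.31) PLUS the neglected terms made explicit: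
  `𝒬₅ + 𝒬₆ + ⟨φ^{(0)}, w₆ψ⟩ + ½⟨ψ, w₇ψ⟩` (the *"terms at ∂Λ₇^{(0)}"* and the *"local terms of the order of e^{−cr(e₀)}"* of p. 270, in the explicit
  forms of `BIJ88ScalarSummary583`: `Ops.Q5`, `Ops.Q6`, `Ops.w6`, `Ops.w7`); `eq331_transl581` — the same for r16's typed translation `transl581`
  (= (3.30) with `aL⁻²` entered as `O.a`).

**Readings (declared).**  (i) the laws `Ops.Laws` of `BIJ88ScalarSummary583` (Δ, Λ₈′ symmetric, `⟨Qx, Qy⟩ = ⟨x, Py⟩`, adjoint pairs, the identity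
of [7] at step 0 with `Δ^L_{1,loc}` = `Ops.deltaLloc`); (ii) real Hilbert-space reading.  **What is NOT claimed.**  (3.29) itself (the expansion in
`θ₀A^{(0)}`: r18's `BIJ88Sect3Translations.eq329`), the sizes *"of the order of e^{−cr(e₀)}"* of the neglected terms, r18's kernel-level typing
`BIJ88Sect3Translations.basicForms331` (a different carrier; not bridged here); nothing of B1–B16; NOT summit progress; NOT continuum; NOT
Clay.  Imports `BIJ88ScalarSummary583` only; no Summits import; sub-namespace `…BIJ88BasicForms331`; modifies nothing.  Cell `lit-balaban` Phase 2
(HOME `run/shared/lean/pub/lit-balaban/`), seat p02 gen 5; row **C2.Eq3.31** (owner r18, referee ref-5): derivation (3.29)→(3.31) proved on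
the End carrier (the row's DEF head is r18's).
-/

open scoped RealInnerProductSpace
namespace Literature.MathematicalPhysics.QuantumFieldTheory.BalabanImbrieJaffe1984to88.BIJ88BasicForms331
open BIJ88ScalarTransl582 BIJ88ScalarSummary583 BIJ88Sect5StatementsPart4
noncomputable section

variable {M N F : Type*} [NormedAddCommGroup M] [InnerProductSpace ℝ M] [NormedAddCommGroup N] [InnerProductSpace ℝ N]
  [AddCommGroup F] [Module ℝ F]

/-- at step 0 the scalar forms of (3.29) carry no localization `Λ₈^{(k−1)′}` (`Λ8 = id`), so the form `𝒬₄` of (5.8.2) is absent.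
[cite: BalabanImbrieJaffe1988, (3.31) p.270] -/
theorem Q4_eq_zero_of_id (a : ℝ) (P : M →ₗ[ℝ] M) (φ : M) : Q4 a LinearMap.id P φ = 0 := by
  simp [Q4]

/-- **(3.31)** p. 270 [PDF 14] — the passage (3.29) → (3.30) → (3.31) PROVED as the `k = 0` instance of (5.8.3): for the §5.8 dictionary read at
step 0 (`Λ8 = id`, `Δ` = −Δ_{u₁}, `P` = Q(u₁)*Q(u₁), `a` = aL⁻², `T` = the translation (3.30)),
`½⟨φ, −Δ_{u₁}φ⟩ + ½aL⁻²‖ψ − Q(u₁)φ‖²` at `φ = φ^{(0)} + Tψ` `=` *"the basic quadratic forms"* `½⟨φ^{(0)}, (−Δ_{u₁} + aL⁻²Q(u₁)*Q(u₁))φ^{(0)}⟩ +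
½⟨Λ₈^{(0)′}ψ, Δ^L_{1,loc}(u₁)Λ₈^{(0)′}ψ⟩` `+` the neglected terms made explicit `𝒬₅ + 𝒬₆ + ⟨φ^{(0)}, w₆ψ⟩ + ½⟨ψ, w₇ψ⟩`.
[cite: BalabanImbrieJaffe1988, (3.31) p.270] -/
theorem eq331 (O : Ops M N F) (h : O.Laws) (h8 : O.Λ8 = LinearMap.id) (φ0 : M) (ψ : N) :
    scalarForms O.a O.Λ8 O.Δ O.Q (φ0 + O.T ψ) ψ =
      (1 / 2) * ⟪φ0, O.Δ φ0 + O.a • O.P φ0⟫ + (1 / 2) * ⟪O.Λ8' ψ, O.deltaLloc (O.Λ8' ψ)⟫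
        + (O.Q5 φ0 ψ + O.Q6 ψ + ⟪φ0, O.w6 ψ⟫ + (1 / 2) * ⟪ψ, O.w7 ψ⟫) := by
  rw [O.eq583 h, h8, Q4_eq_zero_of_id]
  simp only [LinearMap.id_apply]
  ring

/-- (3.31) for r16's typed translation `transl581` ((5.8.1) = (3.30) at step 0, `aL⁻²` entered as `O.a`). [cite: BalabanImbrieJaffe1988, (3.31) p.270] -/
theorem eq331_transl581 (O : Ops M N F) (h : O.Laws) (h8 : O.Λ8 = LinearMap.id) {a₀ L : ℝ} (ha : O.a = a₀ * L⁻¹ ^ 2)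
    (φ0 : M) (ψ : N) :
    scalarForms O.a O.Λ8 O.Δ O.Q (transl581 a₀ L O.Λ7 O.Cloc O.Qst φ0 ψ) ψ =
      (1 / 2) * ⟪φ0, O.Δ φ0 + O.a • O.P φ0⟫ + (1 / 2) * ⟪O.Λ8' ψ, O.deltaLloc (O.Λ8' ψ)⟫
        + (O.Q5 φ0 ψ + O.Q6 ψ + ⟪φ0, O.w6 ψ⟫ + (1 / 2) * ⟪ψ, O.w7 ψ⟫) := by
  rw [O.transl581_eq_T ha, eq331 O h h8]

/-- with no localization at all on the `ψ` side either (`Λ₈^{(0)′} = I`) the neglected terms reduce to the two kernels: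
`⟨φ^{(0)}, w₆ψ⟩ + ½⟨ψ, w₇ψ⟩`. [cite: BalabanImbrieJaffe1988, (3.31) p.270] -/
theorem eq331_noLoc (O : Ops M N F) (h : O.Laws) (h8 : O.Λ8 = LinearMap.id) (h8' : O.Λ8' = LinearMap.id) (φ0 : M) (ψ : N) :
    scalarForms O.a O.Λ8 O.Δ O.Q (φ0 + O.T ψ) ψ =
      (1 / 2) * ⟪φ0, O.Δ φ0 + O.a • O.P φ0⟫ + (1 / 2) * ⟪ψ, O.deltaLloc ψ⟫ + (⟪φ0, O.w6 ψ⟫ + (1 / 2) * ⟪ψ, O.w7 ψ⟫) := by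
  have h56 := O.Q5_Q6_eq_zero_of_id h8' φ0 ψ
  rw [eq331 O h h8, h56.1, h56.2, h8']
  simp only [LinearMap.id_apply]
  ring

end

end Literature.MathematicalPhysics.QuantumFieldTheory.BalabanImbrieJaffe1984to88.BIJ88BasicForms331
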